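import Literature.MathematicalPhysics.QuantumLattice.HubbardTTPrimeGrandCanonicalGibbsMixture
import Literature.MathematicalPhysics.QuantumLattice.InfVolFermionStateTorusLimitEnergyEntropyBalance
import Literature.MathematicalPhysics.QuantumLattice.TorusLimitOfMixtures
import HarnessLib

/-!
# Thermal grand-canonical states of the 2D `t–t'` Hubbard model satisfy the FULL KMS row family:
# stationarity and the linearised energy–entropy balance rows for EVERY local generator, charged or not

Family `hubbard` (topic `MathematicalPhysics/QuantumLattice`). The grand-canonical companion of
`InfVolFermionStateTorusLimitEnergyEntropyBalance` (rows of CANONICAL torus limits, restricted — as they must be — to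
generators conserving `N` and `S^z`) and of `InfVolFermionStateTorusLimitTwoSectorEnergyEntropyBalance` (whose header
records that the charged rows "hold for the grand-canonical KMS object", there replaced by two-state rows with a ratio
parameter). Here the thermal object IS grand-canonical: a torus limit `ω` of the Gibbs states
`e^{−βK_L}/tr e^{−βK_L}`, `K_L(t,t',U,μ,h) = H_L − μN − hM` (`gcTorusHamiltonianTT'`; eigen-mixtures
`(sourcedGibbsCount, gcGibbsWeightTT' β …, gcGibbsVectorTT' …)` of `HubbardTTPrimeGrandCanonicalGibbsMixture`), and
for such `ω` the rows hold for ONE state and EVERY local generator `A` (`c_{xσ}`, `c†c†`, pair fields, …), with the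
local GRAND-CANONICAL Hamiltonian

  `K_Λ(t,t',U,μ,h) = H^{tt'}_Λ − μ N_Λ − h (N↑_Λ − N↓_Λ)`   (`gcLocalHamiltonianTT'`, §1)

as the generator of the dynamics (for charged `A` the `μN`/`hM` terms do not drop — they carry the chemical
potential into the rows):

* §2 LOCALITY ON THE TORUS: commutators of on-site sums with embedded observables are embedded local commutators
  (`sum_commutator_fermionEmbed_toTorusEmb`, the commutator form of `commute_fermionEmbed_toTorusEmb_sum`; instances
  `spinNumber_/totalNumber_/spinImbalance_commutator_fermionEmbed_toTorusEmb`), hence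
  **`[K_L, ΓÃ] = Γ[K_{Λ'}, Ã]`** for `Ã = Γ_{Λ⊆Λ'}A`, `thicken Λ 1 ⊆ Λ'`
  (`gcTorusHamiltonianTT'_commutator_fermionEmbed`, on top of `hubbardTorusTT'_commutator_fermionEmbed`).
* §3 FINITE VOLUME: the translations commute with `K_L` (`fockTranslate_commute_gcTorusHamiltonianTT'`); the
  linearised EEB inequality `0 ≤ Σ_i p_{L,i} Re⟨U_vψ_{L,i}, (β·Bᴴ(K_LB − BK_L) − s·BᴴB + q·BBᴴ) U_vψ_{L,i}⟩`
  (`e^{s−1} ≤ q`) holds for EVERY torus operator `B` (`sum_gcGibbsWeightTT'_mul_re_expect_eeb_fockTranslate_nonneg`: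
  the generic sector lemma `sum_canonicalWeight_mul_re_expect_eeb_mulVec_nonneg` on the TRIVIAL sector, where every
  sector-bookkeeping hypothesis is vacuous), and every translated component is stationary
  (`star_fockTranslate_mulVec_gcGibbsVectorTT'_dotProduct_commutator_mulVec_eq_zero`).
* §4 translation averages of the embedded rows at fixed `L` (`re_sum_gcGibbsWeightTT'_mul_torusAvgExpectAt_eeb_nonneg`,
  `torusAvgExpectAt_commutator_gcLocalHamiltonianTT'_gcGibbsVectorTT'`).
* §5 THE ROWS OF THERMAL GRAND-CANONICAL STATES (any real `β, t, t', U, μ, h`; `Λ ⊆ Λ'`, `thicken Λ 1 ⊆ Λ'`):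
  stationarity `ω_{Λ'}(K_{Λ'}ΓB − ΓB K_{Λ'}) = 0` for every `B ∈ 𝔄_Λ`
  (`IsTorusLimitOfMixture.expect_commutator_gcLocalHamiltonianTT'_eq_zero_of_gcGibbs`) and
  **`0 ≤ Re ω_{Λ'}(β·Ãᴴ(K_{Λ'}Ã − ÃK_{Λ'}) − s·ÃᴴÃ + q·ÃÃᴴ)` for EVERY `A ∈ 𝔄_Λ`**
  (`IsTorusLimitOfMixture.re_expect_eeb_nonneg_of_gcGibbs`, minimal-window form `…_thicken_…`).

Reading for the `T > 0` certificate family (hubbard-thermal): a state relaxation over translation-invariant states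
with the FULL Fawzi–Fawzi–Scalet row family (stationarity + EEB for all local words, charged included) at parameters
`(β; t,t',U; μ,h)` has every thermal grand-canonical state in its feasible set — ONE state, no companion, no
partition-function ratio; its certified bounds are `μ`-keyed words for these states, which
`HubbardTTPrimeGrandCanonicalThermalStates{,Ensembles}` place on the density axis (`0 < ρ(ω) < 2`, the logistic
window, three-pressure brackets). One definition with body (`gcLocalHamiltonianTT'`); everything else PROVED; no
named fact, no sorry, no instance. WHAT THIS IS NOT: the converse (rows ⇒ KMS), a uniqueness statement, or a number.

## Mathlib / tree search

`lean search 'eeb.*gcGibbs|commutator_fermionEmbed_toTorusEmb|gcLocalHamiltonian'`: nothing (2026-08-27); the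
canonical rows are `IsTorusLimitOfMixture.re_expect_eeb_nonneg_of_sectorGibbs` /
`….expect_commutator_localHamiltonian_eq_zero_of_sectorGibbs`. REUSED: `sum_canonicalWeight_mul_re_expect_eeb_mulVec_nonneg`,
`star_mulVec_dotProduct_commutator_mulVec_mulVec_eq_zero`, `fockTranslate_val_conjTranspose_mul_val_mul`,
`fockTranslate_val_mul_val_conjTranspose_mul` (`TorusGibbsEnergyEntropyBalance`); `hubbardTorusTT'_commutator_fermionEmbed`
(`HubbardNNNHoppingLocalHamiltonian`); `fockTranslate_commute_hubbardTorusTT'`, `fockRelabel_commute_of_relabel_eq`,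
`relabel_sum`, `relabel_translate_numberOp` (`FockRelabel`, `HubbardNNNHoppingWindowCertificate`);
`commute_of_mem_carEvenSubalgebra`, `fermionEmbed_mem_carSubalgebra`, `numberOp_mem_carEvenSubalgebra`,
`orbs_map_toTorusEmb_subset`, `injOn_ofTorusSite_proj`; `torusAvgExpectAt_of_injOn`, `torusAvgExpect_eq`,
`eventually_injOn_proj_of_tendsto` (`InfVolFermionState`); `gcTorusHamiltonianTT'*`, `gcGibbs*TT'`,
`canonicalWeight_comp_equiv'`, `sourcedGibbsIndex` (`HubbardTTPrimeGrandCanonicalGibbsMixture`, `DWaveSourceThermalGibbs*`).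

## References

* H. Fawzi, O. Fawzi, S. O. Scalet, Nat. Commun. 15 (2024) 7394 = arXiv:2311.18706, §3.1 Thm. 3.1 (a state is
  `β`-KMS iff it is stationary and satisfies the EEB inequalities), §3.2. [cite: FawziFawziScalet2024, Thm. 3.1]
* H. Araki, H. Moriya, Rev. Math. Phys. 15 (2003) 93, Def. 6.3 / Thm. 6.4 (KMS states of lattice fermion systems
  for the dynamics generated by a general even interaction). [cite: ArakiMoriya2003, Def. 6.3]
* O. Bratteli, D. W. Robinson, *Operator Algebras and Quantum Statistical Mechanics 2* (1997), Thm. 6.2.4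
  (`δ(A) = i[H_{Λ'}, A]`), §5.2.2 Thm. 5.2.5, Thm. 5.3.15. [cite: BratteliRobinsonII1997, Thm. 6.2.4]
* E. H. Lieb, Phys. Rev. Lett. 62 (1989) 1201 (the `(N↑,N↓)` charges). [cite: LiebPRL1989, proof of Theorem 1]
-/

noncomputable section

namespace Literature.MathematicalPhysics.QuantumLattice

open Matrix Finset HubbardWave0 Literature.Probability.LatticeModels ThermodynamicLimit LiebThm1
open _root_.Filter
open scoped _root_.Topology ComplexOrder BigOperators

/-! ### §1 The local grand-canonical Hamiltonian and the charges `N`, `M = N↑ − N↓` of a region -/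

section Local

/-- `N = N↑ + N↓` on any finite orbital set. [cite: Lieb1995] -/
theorem totalNumber_eq_spinNumber_add_spinNumber {Λ : Type*} [LinearOrder Λ] [Fintype Λ] :
    (totalNumber : Matrix (Finset (Orb Λ)) (Finset (Orb Λ)) ℂ) =
      (∑ y : Λ, numberOp y 0) + ∑ y : Λ, numberOp y 1 := by
  rw [totalNumber, ← Finset.sum_add_distrib]
  exact Finset.sum_congr rfl fun y _ => Fin.sum_univ_two _

/-- `M = N↑ − N↓` on any finite orbital set. [cite: LiebPRL1989, proof of Theorem 1] -/
theorem spinImbalance_eq_spinNumber_sub_spinNumber {Λ : Type*} [LinearOrder Λ] [Fintype Λ] :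
    (spinImbalance : Matrix (Finset (Orb Λ)) (Finset (Orb Λ)) ℂ) =
      (∑ y : Λ, numberOp y 0) - ∑ y : Λ, numberOp y 1 := by
  rw [spinImbalance, Finset.sum_sub_distrib]

/-- **The local grand-canonical `t–t'` Hamiltonian of a region** `Λ ⊂ ℤ²`:
`K_Λ(t,t',U,μ,h) = H^{tt'}_Λ − μ N_Λ − h (N↑_Λ − N↓_Λ)` (free boundary conditions; the generator of the
local grand-canonical dynamics). [cite: BratteliRobinsonII1997, Thm. 6.2.4] -/
def gcLocalHamiltonianTT' (Λ : Finset (Site 2)) (t t' U μ hz : ℝ) : FermionOp Λ :=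
  (hubbardTTPrimeFermionInteraction t t' U).localHamiltonian Λ - (μ : ℂ) • totalNumber - (hz : ℂ) • spinImbalance

/-- Unfolding lemma. [cite: BratteliRobinsonII1997, Thm. 6.2.4] -/
theorem gcLocalHamiltonianTT'_eq (Λ : Finset (Site 2)) (t t' U μ hz : ℝ) :
    gcLocalHamiltonianTT' Λ t t' U μ hz =
      (hubbardTTPrimeFermionInteraction t t' U).localHamiltonian Λ - (μ : ℂ) • totalNumber -
        (hz : ℂ) • spinImbalance := rfl

end Local

/-! ### §2 Locality on the torus: commutators of on-site charges and of `K_L` with embedded observables -/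

section TorusLocality

variable {d : ℕ} (L : ℕ) [NeZero L]

/-- **Commutators of on-site sums with embedded observables are embedded local commutators.** If
`g a` is even and supported on the orbitals of the site `a`, `gloc p` are local terms with
`Γ(gloc p) = g(ι p)` on the image of `Λ`, then
`(Σ_a g a) ΓA − ΓA (Σ_a g a) = Γ((Σ_p gloc p) A − A (Σ_p gloc p))` — the terms off the image are even and
far from `ΓA` (the commutator version of `commute_fermionEmbed_toTorusEmb_sum`).
[cite: BratteliRobinsonII1997, Thm. 6.2.4] -/
theorem sum_commutator_fermionEmbed_toTorusEmb {Λ : Finset (Site d)} (h : Set.InjOn (Torus.proj (d := d) L) ↑Λ)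
    (A : FermionOp Λ) (g : FermionTorus d L → Matrix (Finset (Orb (FermionTorus d L))) (Finset (Orb (FermionTorus d L))) ℂ)
    (gloc : PolySite Λ → FermionOp Λ) (hg : ∀ a, g a ∈ carEvenSubalgebra (orbs {a}))
    (hgg : ∀ p : PolySite Λ, fermionEmbed (PolySite.toTorusEmb L h) (gloc p) = g (PolySite.toTorusEmb L h p)) :
    (∑ a, g a) * fermionEmbed (PolySite.toTorusEmb L h) A - fermionEmbed (PolySite.toTorusEmb L h) A * (∑ a, g a) =
      fermionEmbed (PolySite.toTorusEmb L h) ((∑ p, gloc p) * A - A * (∑ p, gloc p)) := by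
  have hι : Set.InjOn (fun x : Site d => FermionTorus.ofTorusSite (Torus.proj L x)) ↑Λ := injOn_ofTorusSite_proj L h
  -- the image part is `Γ(Σ gloc)`
  have himage : ∑ a ∈ Λ.image (fun x => FermionTorus.ofTorusSite (Torus.proj L x)), g a =
      fermionEmbed (PolySite.toTorusEmb L h) (∑ p, gloc p) := by
    let e : PolySite Λ ≃ {x // x ∈ Λ} :=
      ⟨fun a => ⟨ofLex a.1, PolySite.ofLex_mem a⟩, fun x => PolySite.pt x.1 x.2, fun a => PolySite.pt_ofLex a,
        fun x => Subtype.ext rfl⟩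
    rw [Finset.sum_image hι, fermionEmbed_sum, ← Finset.sum_attach Λ, ← Finset.univ_eq_attach]
    refine (Fintype.sum_equiv e _ _ fun a => ?_).symm
    rw [hgg, show PolySite.toTorusEmb L h a = FermionTorus.ofTorusSite (Torus.proj L (e a).1) from rfl]
  -- the rest is even and far from the image
  have hfar : ∑ a ∈ (Λ.image (fun x => FermionTorus.ofTorusSite (Torus.proj L x)))ᶜ, g a ∈
      carEvenSubalgebra (orbs (Λ.image fun x => FermionTorus.ofTorusSite (Torus.proj L x)))ᶜ := by
    refine sum_mem fun a ha => carEvenSubalgebra_mono (fun i hi => ?_) (hg a)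
    rw [mem_orbs, Finset.mem_singleton] at hi
    rw [Finset.mem_compl, mem_orbs, hi]
    exact Finset.mem_compl.1 ha
  have hcomm : Commute (∑ a ∈ (Λ.image (fun x => FermionTorus.ofTorusSite (Torus.proj L x)))ᶜ, g a)
      (fermionEmbed (PolySite.toTorusEmb L h) A) :=
    commute_of_mem_carEvenSubalgebra hfar (fermionEmbed_mem_carSubalgebra _ A)
      (disjoint_compl_left_iff.2 (orbs_map_toTorusEmb_subset L h))
  rw [← Finset.sum_add_sum_compl (Λ.image fun x => FermionTorus.ofTorusSite (Torus.proj L x)), himage,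
    Matrix.add_mul, Matrix.mul_add, hcomm.eq, add_sub_add_right_eq_sub, ← fermionEmbed_mul, ← fermionEmbed_mul,
    ← fermionEmbed_sub]

/-- **Spin numbers**: `N_σ ΓA − ΓA N_σ = Γ(N_{σ,Λ} A − A N_{σ,Λ})` for every local `A ∈ 𝔄_Λ`.
[cite: BratteliRobinsonII1997, Thm. 6.2.4] -/
theorem spinNumber_commutator_fermionEmbed_toTorusEmb {Λ : Finset (Site d)}
    (h : Set.InjOn (Torus.proj (d := d) L) ↑Λ) (A : FermionOp Λ) (σ : Fin 2) :
    (∑ a : FermionTorus d L, numberOp a σ) * fermionEmbed (PolySite.toTorusEmb L h) A -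
        fermionEmbed (PolySite.toTorusEmb L h) A * (∑ a : FermionTorus d L, numberOp a σ) =
      fermionEmbed (PolySite.toTorusEmb L h)
        ((∑ p : PolySite Λ, numberOp p σ) * A - A * (∑ p : PolySite Λ, numberOp p σ)) :=
  sum_commutator_fermionEmbed_toTorusEmb L h A (fun a => numberOp a σ) (fun p => numberOp p σ)
    (fun a => numberOp_mem_carEvenSubalgebra (orb_mem_orbs.2 (Finset.mem_singleton_self a)))
    (fun p => fermionEmbed_numberOp _ p σ)

/-- **Particle number**: `N ΓA − ΓA N = Γ(N_Λ A − A N_Λ)` for every local `A` (charged or not).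
[cite: BratteliRobinsonII1997, Thm. 6.2.4] -/
theorem totalNumber_commutator_fermionEmbed_toTorusEmb {Λ : Finset (Site d)}
    (h : Set.InjOn (Torus.proj (d := d) L) ↑Λ) (A : FermionOp Λ) :
    (totalNumber : Matrix (Finset (Orb (FermionTorus d L))) (Finset (Orb (FermionTorus d L))) ℂ) *
          fermionEmbed (PolySite.toTorusEmb L h) A -
        fermionEmbed (PolySite.toTorusEmb L h) A * totalNumber =
      fermionEmbed (PolySite.toTorusEmb L h) ((totalNumber : FermionOp Λ) * A - A * totalNumber) := by
  rw [totalNumber_eq_spinNumber_add_spinNumber, totalNumber_eq_spinNumber_add_spinNumber, Matrix.add_mul,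
    Matrix.mul_add, add_sub_add_comm, spinNumber_commutator_fermionEmbed_toTorusEmb L h A 0,
    spinNumber_commutator_fermionEmbed_toTorusEmb L h A 1, ← fermionEmbed_add, Matrix.add_mul, Matrix.mul_add,
    add_sub_add_comm]

/-- **Spin imbalance**: `M ΓA − ΓA M = Γ(M_Λ A − A M_Λ)` for every local `A`.
[cite: BratteliRobinsonII1997, Thm. 6.2.4] -/
theorem spinImbalance_commutator_fermionEmbed_toTorusEmb {Λ : Finset (Site d)}
    (h : Set.InjOn (Torus.proj (d := d) L) ↑Λ) (A : FermionOp Λ) :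
    (spinImbalance : Matrix (Finset (Orb (FermionTorus d L))) (Finset (Orb (FermionTorus d L))) ℂ) *
          fermionEmbed (PolySite.toTorusEmb L h) A -
        fermionEmbed (PolySite.toTorusEmb L h) A * spinImbalance =
      fermionEmbed (PolySite.toTorusEmb L h) ((spinImbalance : FermionOp Λ) * A - A * spinImbalance) := by
  rw [spinImbalance_eq_spinNumber_sub_spinNumber, spinImbalance_eq_spinNumber_sub_spinNumber, Matrix.sub_mul,
    Matrix.mul_sub, sub_sub_sub_comm, spinNumber_commutator_fermionEmbed_toTorusEmb L h A 0,
    spinNumber_commutator_fermionEmbed_toTorusEmb L h A 1, ← fermionEmbed_sub, Matrix.sub_mul, Matrix.mul_sub,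
    sub_sub_sub_comm]

end TorusLocality

section TorusLocalityTT

variable (L : ℕ) [NeZero L] (t t' U μ hz : ℝ)

/-- **The commutator with the grand-canonical torus Hamiltonian is the embedded local commutator**: for
`A ∈ 𝔄_Λ` embedded through `Λ' ⊇ thicken Λ 1` (`x ↦ x mod L` injective on `thicken Λ' 1`),
`[K_L, ΓA] = Γ([K_{Λ'}, A])` with `K_{Λ'} = gcLocalHamiltonianTT' Λ' t t' U μ h` — the `t–t'` part is
`hubbardTorusTT'_commutator_fermionEmbed`, the charges `N`, `M` are on-site sums. For CHARGED `A` the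
`μN` and `hM` terms do not drop. [cite: BratteliRobinsonII1997, Thm. 6.2.4] -/
theorem gcTorusHamiltonianTT'_commutator_fermionEmbed {Λ Λ' : Finset (Site 2)} (hΛ : Λ ⊆ Λ')
    (h8 : thicken Λ 1 ⊆ Λ') (hInj : Set.InjOn (Torus.proj (d := 2) L) ↑(thicken Λ' 1)) (A : FermionOp Λ) :
    gcTorusHamiltonianTT' L t t' U μ hz *
          fermionEmbed (PolySite.toTorusEmb L (hInj.mono (by exact_mod_cast subset_thicken Λ' 1)))
            (fermionEmbed (PolySite.incl hΛ) A) -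
        fermionEmbed (PolySite.toTorusEmb L (hInj.mono (by exact_mod_cast subset_thicken Λ' 1)))
            (fermionEmbed (PolySite.incl hΛ) A) * gcTorusHamiltonianTT' L t t' U μ hz =
      fermionEmbed (PolySite.toTorusEmb L (hInj.mono (by exact_mod_cast subset_thicken Λ' 1)))
        (gcLocalHamiltonianTT' Λ' t t' U μ hz * fermionEmbed (PolySite.incl hΛ) A -
          fermionEmbed (PolySite.incl hΛ) A * gcLocalHamiltonianTT' Λ' t t' U μ hz) := by
  have h₁ : Set.InjOn (Torus.proj (d := 2) L) ↑Λ' := hInj.mono (by exact_mod_cast subset_thicken Λ' 1)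
  set B := fermionEmbed (PolySite.incl hΛ) A with hB
  have hH := hubbardTorusTT'_commutator_fermionEmbed L t t' U hΛ h8 hInj A
  have hN := totalNumber_commutator_fermionEmbed_toTorusEmb L h₁ B
  have hM := spinImbalance_commutator_fermionEmbed_toTorusEmb L h₁ B
  rw [gcTorusHamiltonianTT', gcLocalHamiltonianTT', Matrix.sub_mul, Matrix.sub_mul, Matrix.mul_sub, Matrix.mul_sub,
    Matrix.smul_mul, Matrix.smul_mul, Matrix.mul_smul, Matrix.mul_smul,
    show ∀ a b c a' b' c' : Matrix (Finset (Orb (FermionTorus 2 L))) (Finset (Orb (FermionTorus 2 L))) ℂ,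
      a - b - c - (a' - b' - c') = (a - a') - (b - b') - (c - c') from fun _ _ _ _ _ _ => by abel,
    ← smul_sub, ← smul_sub, hH, hN, hM, ← fermionEmbed_smul, ← fermionEmbed_smul, ← fermionEmbed_sub,
    ← fermionEmbed_sub, Matrix.sub_mul, Matrix.sub_mul, Matrix.mul_sub, Matrix.mul_sub, Matrix.smul_mul,
    Matrix.smul_mul, Matrix.mul_smul, Matrix.mul_smul, smul_sub, smul_sub]
  congr 1
  abel

end TorusLocalityTT

/-! ### §3 Finite volume: translations commute with `K_L`; EEB and stationarity in the translated
grand-canonical eigen-mixtures, for EVERY torus operator -/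

section FiniteVolume

variable (L : ℕ) [NeZero L] (β t t' U μ hz : ℝ)

/-- The spin numbers are translation invariant: `relabel (translate v) N_σ = N_σ`. [folklore] -/
private theorem relabel_translate_spinNumber (v : TorusSite 2 L) (σ : Fin 2) :
    relabel (Orb.translate v) (∑ a : FermionTorus 2 L, numberOp a σ) = ∑ a : FermionTorus 2 L, numberOp a σ := by
  rw [relabel_sum]
  have h1 : ∑ a : FermionTorus 2 L, relabel (Orb.translate v) (numberOp a σ) =
      ∑ x : TorusSite 2 L, numberOp (FermionTorus.ofTorusSite (x + v)) σ := by
    refine (Fintype.sum_equiv FermionTorus.equivTorusSite _ _ fun a => ?_)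
    rw [← relabel_translate_numberOp]
    congr 2
    exact (FermionTorus.ofTorusSite_toTorusSite a).symm
  rw [h1]
  exact Fintype.sum_equiv ((Equiv.addRight v).trans FermionTorus.equivTorusSite.symm) _ _ fun x => rfl

/-- **The translations commute with the grand-canonical torus Hamiltonian** `K_L(t,t',U,μ,h)`.
[cite: BratteliRobinsonII1997, §5.2.2, Thm. 5.2.5] -/
theorem fockTranslate_commute_gcTorusHamiltonianTT' (v : TorusSite 2 L) :
    Commute (fockTranslate v).val (gcTorusHamiltonianTT' L t t' U μ hz) := by
  have hN : Commute (fockTranslate v).val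
      (totalNumber : Matrix (Finset (Orb (FermionTorus 2 L))) (Finset (Orb (FermionTorus 2 L))) ℂ) := by
    rw [totalNumber_eq_spinNumber_add_spinNumber]
    exact (fockRelabel_commute_of_relabel_eq _ (relabel_translate_spinNumber L v 0)).add_right
      (fockRelabel_commute_of_relabel_eq _ (relabel_translate_spinNumber L v 1))
  have hM : Commute (fockTranslate v).val
      (spinImbalance : Matrix (Finset (Orb (FermionTorus 2 L))) (Finset (Orb (FermionTorus 2 L))) ℂ) := by
    rw [spinImbalance_eq_spinNumber_sub_spinNumber]
    exact (fockRelabel_commute_of_relabel_eq _ (relabel_translate_spinNumber L v 0)).sub_right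
      (fockRelabel_commute_of_relabel_eq _ (relabel_translate_spinNumber L v 1))
  rw [gcTorusHamiltonianTT']
  exact ((fockTranslate_commute_hubbardTorusTT' L v t t' U).sub_right (hN.smul_right _)).sub_right (hM.smul_right _)

/-- **The linearised EEB inequality for the translated grand-canonical Gibbs mixtures, EVERY torus
operator `B`** (no conservation law needed: the mixture lives on the whole Fock space): for a translation
`v`, all real `s, q` with `e^{s−1} ≤ q`,
`0 ≤ Σ_i p_{L,i} Re⟨U_vψ_{L,i}, (β·Bᴴ(K_L B − B K_L) − s·BᴴB + q·BBᴴ) U_vψ_{L,i}⟩`.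
[cite: FawziFawziScalet2024, Thm. 3.1] -/
theorem sum_gcGibbsWeightTT'_mul_re_expect_eeb_fockTranslate_nonneg (v : TorusSite 2 L)
    (B : Matrix (Finset (Orb (FermionTorus 2 L))) (Finset (Orb (FermionTorus 2 L))) ℂ) {s q : ℝ}
    (hq : Real.exp (s - 1) ≤ q) :
    0 ≤ ∑ i, gcGibbsWeightTT' β t t' U μ hz L i *
      (star ((fockTranslate v).val *ᵥ gcGibbsVectorTT' t t' U μ hz L i) ⬝ᵥ
        ((((β : ℝ) : ℂ) • (Bᴴ * (gcTorusHamiltonianTT' L t t' U μ hz * B - B * gcTorusHamiltonianTT' L t t' U μ hz)) -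
            ((s : ℝ) : ℂ) • (Bᴴ * B) + ((q : ℝ) : ℂ) • (B * Bᴴ)) *ᵥ
          ((fockTranslate v).val *ᵥ gcGibbsVectorTT' t t' U μ hz L i))).re := by
  set K := gcTorusHamiltonianTT' L t t' U μ hz with hKdef
  have hK : K.IsHermitian := gcTorusHamiltonianTT'_isHermitian L t t' U μ hz
  have hvac : ∀ (X : Matrix (Finset (Orb (FermionTorus 2 L))) (Finset (Orb (FermionTorus 2 L))) ℂ)
      (i j : Finset (Orb (FermionTorus 2 L))), ¬ (fun _ => True) i → (fun _ => True) j → X i j = 0 :=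
    fun _ _ _ hi _ => (hi trivial).elim
  have key := sum_canonicalWeight_mul_re_expect_eeb_mulVec_nonneg (fun _ => True) hK (hvac K)
    (fockTranslate_val_conjTranspose_mul_val_mul L v) (fockTranslate_val_mul_val_conjTranspose_mul L v)
    (fockTranslate_commute_gcTorusHamiltonianTT' L t t' U μ hz v) (hvac _) (hvac _) (hvac B) (hvac Bᴴ) β hq
  set e := sourcedGibbsIndex L with he
  refine key.trans_eq ?_
  rw [← Equiv.sum_comp e]
  refine Finset.sum_congr rfl fun i _ => ?_
  rw [gcGibbsWeightTT', show gcGibbsEnergyTT' t t' U μ hz L = sectorEigenvalue (fun _ => True) K hK ∘ e from rfl,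
    canonicalWeight_comp_equiv']
  rfl

/-- **Stationarity of the translated grand-canonical Gibbs components**: `U_vψ_{L,i}` is an eigenvector of
`K_L`, so `⟨U_vψ_{L,i}, (K_L X − X K_L) U_vψ_{L,i}⟩ = 0` for every `X`. [cite: FawziFawziScalet2024, Thm. 3.1] -/
theorem star_fockTranslate_mulVec_gcGibbsVectorTT'_dotProduct_commutator_mulVec_eq_zero (v : TorusSite 2 L)
    (i : Fin (sourcedGibbsCount L)) (X : Matrix (Finset (Orb (FermionTorus 2 L))) (Finset (Orb (FermionTorus 2 L))) ℂ) :
    star ((fockTranslate v).val *ᵥ gcGibbsVectorTT' t t' U μ hz L i) ⬝ᵥ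
      ((gcTorusHamiltonianTT' L t t' U μ hz * X - X * gcTorusHamiltonianTT' L t t' U μ hz) *ᵥ
        ((fockTranslate v).val *ᵥ gcGibbsVectorTT' t t' U μ hz L i)) = 0 :=
  star_mulVec_dotProduct_commutator_mulVec_mulVec_eq_zero (gcTorusHamiltonianTT'_isHermitian L t t' U μ hz)
    (fockTranslate_commute_gcTorusHamiltonianTT' L t t' U μ hz v)
    (gcTorusHamiltonianTT'_mulVec_gcGibbsVectorTT' t t' U μ hz L i) X

end FiniteVolume

/-! ### §4 Translation averages of the embedded local rows -/

section TorusAverage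

variable (L : ℕ) [NeZero L] (β t t' U μ hz : ℝ)

/-- **The EEB row of ANY local generator, averaged over the torus translations, is nonnegative in the
grand-canonical Gibbs mixture.** For `Λ ⊆ Λ'` with `thicken Λ 1 ⊆ Λ'`, `x ↦ x mod L` injective on
`thicken Λ' 1`, every `A ∈ 𝔄_Λ`, `Ã = Γ_{Λ⊆Λ'}A`, `K_{Λ'} = gcLocalHamiltonianTT' Λ' t t' U μ h`, `e^{s−1} ≤ q`:
`0 ≤ Re Σ_i p_{L,i} · torusAvgExpectAt L Λ' (β·Ãᴴ(K_{Λ'}Ã − ÃK_{Λ'}) − s·ÃᴴÃ + q·ÃÃᴴ) ψ_{L,i}`.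
[cite: FawziFawziScalet2024, Thm. 3.1] -/
theorem re_sum_gcGibbsWeightTT'_mul_torusAvgExpectAt_eeb_nonneg {Λ Λ' : Finset (Site 2)} (hΛ : Λ ⊆ Λ')
    (h8 : thicken Λ 1 ⊆ Λ') (hInj : Set.InjOn (Torus.proj (d := 2) L) ↑(thicken Λ' 1)) (A : FermionOp Λ)
    {s q : ℝ} (hq : Real.exp (s - 1) ≤ q) :
    0 ≤ (∑ i, (gcGibbsWeightTT' β t t' U μ hz L i : ℂ) *
      torusAvgExpectAt L Λ'
        (((β : ℝ) : ℂ) • ((fermionEmbed (PolySite.incl hΛ) A)ᴴ *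
            (gcLocalHamiltonianTT' Λ' t t' U μ hz * fermionEmbed (PolySite.incl hΛ) A -
              fermionEmbed (PolySite.incl hΛ) A * gcLocalHamiltonianTT' Λ' t t' U μ hz)) -
          ((s : ℝ) : ℂ) • ((fermionEmbed (PolySite.incl hΛ) A)ᴴ * fermionEmbed (PolySite.incl hΛ) A) +
          ((q : ℝ) : ℂ) • (fermionEmbed (PolySite.incl hΛ) A * (fermionEmbed (PolySite.incl hΛ) A)ᴴ))
        (gcGibbsVectorTT' t t' U μ hz L i)).re := by
  have h₁ : Set.InjOn (Torus.proj (d := 2) L) ↑Λ' := hInj.mono (by exact_mod_cast subset_thicken Λ' 1)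
  set K := gcTorusHamiltonianTT' L t t' U μ hz with hKdef
  set B := fermionEmbed (PolySite.toTorusEmb L h₁) (fermionEmbed (PolySite.incl hΛ) A) with hBdef
  -- pull the row back into the torus
  have hΓ : fermionEmbed (PolySite.toTorusEmb L h₁)
      (((β : ℝ) : ℂ) • ((fermionEmbed (PolySite.incl hΛ) A)ᴴ *
            (gcLocalHamiltonianTT' Λ' t t' U μ hz * fermionEmbed (PolySite.incl hΛ) A -
              fermionEmbed (PolySite.incl hΛ) A * gcLocalHamiltonianTT' Λ' t t' U μ hz)) -
          ((s : ℝ) : ℂ) • ((fermionEmbed (PolySite.incl hΛ) A)ᴴ * fermionEmbed (PolySite.incl hΛ) A) +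
          ((q : ℝ) : ℂ) • (fermionEmbed (PolySite.incl hΛ) A * (fermionEmbed (PolySite.incl hΛ) A)ᴴ)) =
      ((β : ℝ) : ℂ) • (Bᴴ * (K * B - B * K)) - ((s : ℝ) : ℂ) • (Bᴴ * B) + ((q : ℝ) : ℂ) • (B * Bᴴ) := by
    rw [fermionEmbed_add, fermionEmbed_sub, fermionEmbed_smul, fermionEmbed_smul, fermionEmbed_smul,
      fermionEmbed_mul, fermionEmbed_mul, fermionEmbed_mul, fermionEmbed_conjTranspose,
      ← gcTorusHamiltonianTT'_commutator_fermionEmbed L t t' U μ hz hΛ h8 hInj A]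
  -- each translate is nonnegative
  have hv : ∀ v : TorusSite 2 L, 0 ≤ ∑ i, gcGibbsWeightTT' β t t' U μ hz L i *
      (expect (((β : ℝ) : ℂ) • (Bᴴ * (K * B - B * K)) - ((s : ℝ) : ℂ) • (Bᴴ * B) + ((q : ℝ) : ℂ) • (B * Bᴴ))
        ((fockTranslate v).val *ᵥ gcGibbsVectorTT' t t' U μ hz L i)).re := fun v =>
    sum_gcGibbsWeightTT'_mul_re_expect_eeb_fockTranslate_nonneg L β t t' U μ hz v B hq
  have hcast : ((Fintype.card (TorusSite 2 L) : ℂ))⁻¹ = (((Fintype.card (TorusSite 2 L) : ℝ)⁻¹ : ℝ) : ℂ) := by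
    push_cast; rfl
  simp_rw [torusAvgExpectAt_of_injOn L h₁, hΓ]
  rw [Complex.re_sum]
  simp_rw [hcast, ← mul_assoc, ← Complex.ofReal_mul, Complex.re_ofReal_mul, Complex.re_sum, Finset.mul_sum]
  rw [Finset.sum_comm]
  refine Finset.sum_nonneg fun v _ => ?_
  have hfac : ∑ i, gcGibbsWeightTT' β t t' U μ hz L i * (Fintype.card (TorusSite 2 L) : ℝ)⁻¹ *
      (expect (((β : ℝ) : ℂ) • (Bᴴ * (K * B - B * K)) - ((s : ℝ) : ℂ) • (Bᴴ * B) + ((q : ℝ) : ℂ) • (B * Bᴴ))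
        ((fockTranslate v).val *ᵥ gcGibbsVectorTT' t t' U μ hz L i)).re =
      (Fintype.card (TorusSite 2 L) : ℝ)⁻¹ * ∑ i, gcGibbsWeightTT' β t t' U μ hz L i *
      (expect (((β : ℝ) : ℂ) • (Bᴴ * (K * B - B * K)) - ((s : ℝ) : ℂ) • (Bᴴ * B) + ((q : ℝ) : ℂ) • (B * Bᴴ))
        ((fockTranslate v).val *ᵥ gcGibbsVectorTT' t t' U μ hz L i)).re := by
    rw [Finset.mul_sum]
    exact Finset.sum_congr rfl fun i _ => by ring
  rw [hfac]
  exact mul_nonneg (inv_nonneg.2 (Nat.cast_nonneg _)) (hv v)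

/-- **The stationarity row of a local observable vanishes in every translated grand-canonical Gibbs
component**: `torusAvgExpectAt L Λ' (K_{Λ'} ΓB − ΓB K_{Λ'}) ψ_{L,i} = 0`.
[cite: FawziFawziScalet2024, Thm. 3.1] -/
theorem torusAvgExpectAt_commutator_gcLocalHamiltonianTT'_gcGibbsVectorTT' {Λ Λ' : Finset (Site 2)}
    (hΛ : Λ ⊆ Λ') (h8 : thicken Λ 1 ⊆ Λ') (hInj : Set.InjOn (Torus.proj (d := 2) L) ↑(thicken Λ' 1))
    (B : FermionOp Λ) (i : Fin (sourcedGibbsCount L)) :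
    torusAvgExpectAt L Λ'
        (gcLocalHamiltonianTT' Λ' t t' U μ hz * fermionEmbed (PolySite.incl hΛ) B -
          fermionEmbed (PolySite.incl hΛ) B * gcLocalHamiltonianTT' Λ' t t' U μ hz)
        (gcGibbsVectorTT' t t' U μ hz L i) = 0 := by
  have h₁ : Set.InjOn (Torus.proj (d := 2) L) ↑Λ' := hInj.mono (by exact_mod_cast subset_thicken Λ' 1)
  rw [torusAvgExpectAt_of_injOn L h₁, ← gcTorusHamiltonianTT'_commutator_fermionEmbed L t t' U μ hz hΛ h8 hInj B,
    Finset.sum_eq_zero fun v _ => ?_, mul_zero]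
  rw [expect]
  exact star_fockTranslate_mulVec_gcGibbsVectorTT'_dotProduct_commutator_mulVec_eq_zero L t t' U μ hz v i _

end TorusAverage

/-! ### §5 The KMS rows of thermal grand-canonical states: stationarity and EEB for EVERY local generator -/

namespace InfVolFermionState

variable {β : ℝ} (t t' U μ hz : ℝ) {ω : InfVolFermionState 2} {Ls : ℕ → ℕ}

/-- **Stationarity rows of thermal grand-canonical states.** Let `ω` be a torus limit of the
grand-canonical Gibbs states of `K_{Ls j}(t,t',U,μ,h)` along `Ls → ∞` (any `β`). Then for `Λ ⊆ Λ'` with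
`thicken Λ 1 ⊆ Λ'` and EVERY local `B ∈ 𝔄_Λ` (charged or not):
`ω_{Λ'}(K_{Λ'} ΓB − ΓB K_{Λ'}) = 0`, `K_{Λ'} = gcLocalHamiltonianTT' Λ' t t' U μ h` — `ω` is stationary for the
local GRAND-CANONICAL dynamics (Fawzi–Fawzi–Scalet Thm. 3.1 (a)). [cite: FawziFawziScalet2024, Thm. 3.1] -/
theorem IsTorusLimitOfMixture.expect_commutator_gcLocalHamiltonianTT'_eq_zero_of_gcGibbs
    (h : ω.IsTorusLimitOfMixture sourcedGibbsCount (gcGibbsWeightTT' β t t' U μ hz)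
      (gcGibbsVectorTT' t t' U μ hz) Ls)
    (hLs : Tendsto Ls atTop atTop) {Λ Λ' : Finset (Site 2)} (hΛ : Λ ⊆ Λ') (h8 : thicken Λ 1 ⊆ Λ')
    (B : FermionOp Λ) :
    ω.expect Λ'
      (gcLocalHamiltonianTT' Λ' t t' U μ hz * fermionEmbed (PolySite.incl hΛ) B -
        fermionEmbed (PolySite.incl hΛ) B * gcLocalHamiltonianTT' Λ' t t' U μ hz) = 0 := by
  refine tendsto_nhds_unique (h Λ' _) (tendsto_const_nhds.congr' ?_)
  filter_upwards [eventually_injOn_proj_of_tendsto (thicken Λ' 1) hLs, hLs.eventually_ge_atTop 1]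
    with j hInj hj
  haveI : NeZero (Ls j) := ⟨by omega⟩
  refine (Finset.sum_eq_zero fun i _ => ?_).symm
  rw [torusAvgExpect_eq, torusAvgExpectAt_commutator_gcLocalHamiltonianTT'_gcGibbsVectorTT' (Ls j) t t' U μ hz
    hΛ h8 hInj B i, mul_zero]

/-- **Energy–entropy balance rows of thermal grand-canonical states, for EVERY local generator.** Let
`ω` be a torus limit of the grand-canonical Gibbs states of `K_{Ls j}(t,t',U,μ,h)` at inverse temperature
`β` along `Ls → ∞`. Then for `Λ ⊆ Λ'` with `thicken Λ 1 ⊆ Λ'`, EVERY `A ∈ 𝔄_Λ` — conserving nothing: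
`c_{xσ}`, `c†c†`, pair fields included — and all real `s, q` with `e^{s−1} ≤ q`:

  `0 ≤ Re ω_{Λ'}(β·Ãᴴ(K_{Λ'}Ã − ÃK_{Λ'}) − s·ÃᴴÃ + q·ÃÃᴴ)`,  `Ã = Γ_{Λ⊆Λ'}A`, `K_{Λ'} = H^{tt'}_{Λ'} − μN_{Λ'} − hM_{Λ'}`

— the linearisation at slope `s` of the Araki–Sewell inequality `ω(a⋆a) log(ω(a⋆a)/ω(aa⋆)) ≤ β ω(a⋆[K,a])`
of a `β`-KMS state for the grand-canonical dynamics. With the stationarity rows this is the full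
Fawzi–Fawzi–Scalet constraint family of Thm. 3.1 — for ONE state, with `μ` a parameter (the density of
`ω` is then bracketed by `HubbardTTPrimeGrandCanonicalThermalStates{,Ensembles}`), in contrast to the
gauge-invariant rows available for canonical limits. [cite: FawziFawziScalet2024, Thm. 3.1]
[cite: ArakiMoriya2003, Def. 6.3] -/
theorem IsTorusLimitOfMixture.re_expect_eeb_nonneg_of_gcGibbs
    (h : ω.IsTorusLimitOfMixture sourcedGibbsCount (gcGibbsWeightTT' β t t' U μ hz)
      (gcGibbsVectorTT' t t' U μ hz) Ls)
    (hLs : Tendsto Ls atTop atTop) {Λ Λ' : Finset (Site 2)} (hΛ : Λ ⊆ Λ') (h8 : thicken Λ 1 ⊆ Λ')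
    (A : FermionOp Λ) {s q : ℝ} (hq : Real.exp (s - 1) ≤ q) :
    0 ≤ (ω.expect Λ'
      (((β : ℝ) : ℂ) • ((fermionEmbed (PolySite.incl hΛ) A)ᴴ *
          (gcLocalHamiltonianTT' Λ' t t' U μ hz * fermionEmbed (PolySite.incl hΛ) A -
            fermionEmbed (PolySite.incl hΛ) A * gcLocalHamiltonianTT' Λ' t t' U μ hz)) -
        ((s : ℝ) : ℂ) • ((fermionEmbed (PolySite.incl hΛ) A)ᴴ * fermionEmbed (PolySite.incl hΛ) A) +
        ((q : ℝ) : ℂ) • (fermionEmbed (PolySite.incl hΛ) A * (fermionEmbed (PolySite.incl hΛ) A)ᴴ))).re := by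
  refine ge_of_tendsto ((Complex.continuous_re.tendsto _).comp (h Λ' _)) ?_
  filter_upwards [eventually_injOn_proj_of_tendsto (thicken Λ' 1) hLs, hLs.eventually_ge_atTop 1]
    with j hInj hj
  haveI : NeZero (Ls j) := ⟨by omega⟩
  rw [Function.comp_apply]
  simp_rw [torusAvgExpect_eq]
  exact re_sum_gcGibbsWeightTT'_mul_torusAvgExpectAt_eeb_nonneg (Ls j) β t t' U μ hz hΛ h8 hInj A hq

/-- The rows in the minimal window `Λ' = thicken Λ 1`. [cite: FawziFawziScalet2024, Thm. 3.1] -/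
theorem IsTorusLimitOfMixture.re_expect_eeb_thicken_nonneg_of_gcGibbs
    (h : ω.IsTorusLimitOfMixture sourcedGibbsCount (gcGibbsWeightTT' β t t' U μ hz)
      (gcGibbsVectorTT' t t' U μ hz) Ls)
    (hLs : Tendsto Ls atTop atTop) {Λ : Finset (Site 2)} (A : FermionOp Λ) {s q : ℝ}
    (hq : Real.exp (s - 1) ≤ q) :
    0 ≤ (ω.expect (thicken Λ 1)
      (((β : ℝ) : ℂ) • ((fermionEmbed (PolySite.incl (subset_thicken Λ 1)) A)ᴴ *
          (gcLocalHamiltonianTT' (thicken Λ 1) t t' U μ hz * fermionEmbed (PolySite.incl (subset_thicken Λ 1)) A -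
            fermionEmbed (PolySite.incl (subset_thicken Λ 1)) A * gcLocalHamiltonianTT' (thicken Λ 1) t t' U μ hz)) -
        ((s : ℝ) : ℂ) • ((fermionEmbed (PolySite.incl (subset_thicken Λ 1)) A)ᴴ *
          fermionEmbed (PolySite.incl (subset_thicken Λ 1)) A) +
        ((q : ℝ) : ℂ) • (fermionEmbed (PolySite.incl (subset_thicken Λ 1)) A *
          (fermionEmbed (PolySite.incl (subset_thicken Λ 1)) A)ᴴ))).re :=
  h.re_expect_eeb_nonneg_of_gcGibbs t t' U μ hz hLs (subset_thicken Λ 1) subset_rfl A hq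

end InfVolFermionState

end Literature.MathematicalPhysics.QuantumLattice

end
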